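import Mathlib
import HarnessLib
import Summits.HubbardSuperconductivity.HubbardSuperconductivity.Theorems.KLProgrammeSmoothTransitionCauchyBound

/-!
# Route `KLProgramme` — engine support (cell gate-hubbard-kl, #22a (2e) «sharp χ₂ table», seat p2 g18): the pole locus of the complexified
# transition function and ARC-SPLIT sphere majorants for the Cauchy estimates

Continues `…KLProgrammeSmoothTransitionCauchyBound`.  (1) **Pole locus**: if `1 + exp(1/z − 1/(1−z)) = 0` then `Re(1/z) ≤ 1` — indeed
`p = 1/z`, `q = 1/(1−z)` satisfy `p + q = pq`, a pole has `Re p = Re q` and `|Im p − Im q| ≥ π`, which forces `Re p = 1` (the other branch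
`Im p = −Im q` gives `(Re p − 1)² + (Im p)² = 1`, `|Im p − Im q| ≤ 2 < π`).  Hence on EVERY closed disc `|z − x| ≤ r` with `0 < r < x`, `x + r < 1`
(where `Re(1/z) ≥ 1/(x+r) > 1`) the function `F = stC` is holomorphic, and Cauchy's inequality needs a majorant on the SPHERE only.
(2) **Sphere geometry**: on `|z − x| = r`, with `u = Re z`: `|z|² = r² − x² + 2xu`, `|1−z|² = 1 + r² − x² − 2u(1−x)`, `(Im z)² = r² − (u−x)²`;
`Re(1/z) = u/|z|²` is DECREASING in `u`, `Re(1/(1−z)) = (1−u)/|1−z|²` is INCREASING in `u`.  (3) **Three arcs** split at `u = x + d₁`, `u = x + d₂`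
(`−r ≤ d₁ ≤ d₂ ≤ r`): on `u ≤ x + d₁` the real-part route `‖F‖ ≤ (e^{τ₀} − 1)⁻¹` with `τ₀ = g(x+d₁) − h(x+d₁)`; on `x + d₁ ≤ u ≤ x + d₂` the
imaginary-part route `‖F‖ ≤ 1` (resp. `2`) from `|Im(1/z)| + |Im(1/(1−z))| ≤ 3/2` (resp. `5/2`) with the local bounds `|Im z|/|z|²_min`,
`|Im z|/|1−z|²_min`; on `u ≥ x + d₂` the NEGATIVE real-part route `‖F‖ ≤ (1 − e^{−τ₁})⁻¹`, `τ₁ = h(x+d₂) − g(x+d₂)` (`|1 + eʷ| ≥ 1 − e^{Re w}`).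
(4) **`abs_iteratedDeriv_smoothTransition_le_of_sphere`** — Cauchy with any sphere majorant; the arc routes are packaged for the piece file
`…KLProgrammeSmoothTransitionCauchyTableSharp`.  Pure complex analysis; nothing about the model. [cite: KrantzParks2002, Prop. 2.2.10]
-/

noncomputable section

namespace Summit.HubbardSuperconductivity.HubbardSuperconductivity.Theorems.KLRegimeSplit

set_option linter.dupNamespace false -- summit = problem name (single-conjunct summit), D-0017

open Complex Set Metric Filter
open scoped Topology Nat Real

/-! ## §1 The pole locus -/

/-- `‖1 + eʷ‖ ≥ 1 − e^{Re w}`. -/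
theorem stC_norm_one_add_exp_ge_one_sub_exp_re (w : ℂ) : 1 - Real.exp w.re ≤ ‖1 + Complex.exp w‖ := by
  have h : ‖(1 : ℂ)‖ ≤ ‖1 + Complex.exp w‖ + ‖Complex.exp w‖ := by
    calc ‖(1 : ℂ)‖ = ‖(1 + Complex.exp w) - Complex.exp w‖ := by ring_nf
      _ ≤ ‖1 + Complex.exp w‖ + ‖Complex.exp w‖ := norm_sub_le _ _
  rw [Complex.norm_exp, norm_one] at h
  linarith

/-- If `exp w = −1` then `Re w = 0` and `|Im w| ≥ π`. -/
theorem stC_exp_eq_neg_one {w : ℂ} (h : Complex.exp w = -1) : w.re = 0 ∧ Real.pi ≤ |w.im| := by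
  have h1 : Complex.exp w = Complex.exp (Real.pi * I) := by rw [h, Complex.exp_pi_mul_I]
  obtain ⟨k, hk⟩ := Complex.exp_eq_exp_iff_exists_int.1 h1
  have hre : w.re = 0 := by
    have := congrArg Complex.re hk
    simp at this
    exact this
  have him : w.im = (2 * k + 1) * Real.pi := by
    have := congrArg Complex.im hk
    simp at this
    linarith
  refine ⟨hre, ?_⟩
  rw [him, abs_mul, abs_of_pos Real.pi_pos]
  have hk1 : (1 : ℝ) ≤ |(2 * k + 1 : ℝ)| := by
    rcases le_or_gt 0 k with hk0 | hk0
    · rw [abs_of_nonneg (by positivity)]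
      have : (0 : ℝ) ≤ k := by exact_mod_cast hk0
      linarith
    · have : (k : ℝ) ≤ -1 := by exact_mod_cast (Int.le_sub_one_iff.2 hk0 : k ≤ 0 - 1)
      rw [abs_of_neg (by linarith)]
      linarith
  nlinarith [Real.pi_pos]

/-- **Pole locus**: if `z ≠ 0`, `z ≠ 1` and `Re(1/z) > 1` then `1 + exp(1/z − 1/(1−z)) ≠ 0` (all poles of `stC` lie on the circle `Re(1/z) = 1`,
i.e. `|z − ½| = ½`). -/
theorem stC_one_add_exp_ne_zero_of_one_lt_re_inv {z : ℂ} (hz0 : z ≠ 0) (hz1 : (1 : ℂ) - z ≠ 0) (hre : 1 < (z⁻¹).re) :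
    1 + Complex.exp (z⁻¹ - (1 - z)⁻¹) ≠ 0 := by
  intro h
  have hexp : Complex.exp (z⁻¹ - (1 - z)⁻¹) = -1 := by linear_combination h
  obtain ⟨hre0, him⟩ := stC_exp_eq_neg_one hexp
  set p : ℂ := z⁻¹ with hp
  set q : ℂ := (1 - z)⁻¹ with hq
  -- p + q = p q
  have hpq : p + q = p * q := by
    rw [hp, hq]; field_simp; ring
  have hre_eq : p.re = q.re := by
    have := hre0; rw [Complex.sub_re] at this; linarith
  -- components
  have e1 : p.re + q.re = p.re * q.re - p.im * q.im := by
    have := congrArg Complex.re hpq; simpa [Complex.add_re, Complex.mul_re] using this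
  have e2 : p.im + q.im = p.re * q.im + p.im * q.re := by
    have := congrArg Complex.im hpq; simpa [Complex.add_im, Complex.mul_im] using this
  -- with a := p.re = q.re: (1 - a)(p.im + q.im) = 0
  have e3 : (1 - p.re) * (p.im + q.im) = 0 := by rw [← hre_eq] at e2; linarith
  have ha : 1 - p.re ≠ 0 := by rw [hp]; linarith
  have hsum : p.im + q.im = 0 := by
    rcases mul_eq_zero.1 e3 with h | h
    · exact absurd h ha
    · exact h
  have hq' : q.im = -p.im := by linarith
  -- 2a = a² + p.im²  ⇒ (a-1)² + p.im² = 1 ⇒ p.im² ≤ 1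
  have e4 : 2 * p.re = p.re ^ 2 + p.im ^ 2 := by rw [← hre_eq, hq'] at e1; nlinarith [e1]
  have hb : p.im ^ 2 ≤ 1 := by nlinarith
  -- |Im w| = |p.im - q.im| = 2|p.im| ≤ 2 < π
  have hw : |(p - q).im| = 2 * |p.im| := by
    rw [Complex.sub_im, hq', show p.im - -p.im = 2 * p.im by ring, abs_mul, abs_of_pos (by norm_num : (0 : ℝ) < 2)]
  rw [hw] at him
  have habs : |p.im| ≤ 1 := sq_le_one_iff_abs_le_one _ |>.1 hb
  linarith [Real.pi_gt_three]

/-- On the closed disc `|z − x| ≤ r` with `0 < r < x`, `x + r < 1`: `1 + exp(1/z − 1/(1−z)) ≠ 0` (no pole), since `Re(1/z) ≥ 1/(x+r) > 1`. -/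
theorem stC_one_add_exp_ne_zero_of_mem_disc {x r : ℝ} {z : ℂ} (hr : 0 < r) (hrx : r < x) (hx1 : x + r < 1) (hz : ‖z - x‖ ≤ r) :
    1 + Complex.exp (z⁻¹ - (1 - z)⁻¹) ≠ 0 := by
  have h1 : (x + r)⁻¹ ≤ (z⁻¹).re := stC_inv_add_le_re_inv hr hrx hz
  have h2 : 1 < (x + r)⁻¹ := by rw [lt_inv_comm₀ one_pos (by linarith), inv_one]; exact hx1
  exact stC_one_add_exp_ne_zero_of_one_lt_re_inv (stC_ne_zero_of_mem_disc hrx hz) (stC_one_sub_ne_zero_of_mem_disc hx1 hz) (by linarith)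

/-- **Cauchy with a sphere majorant**: for `0 < r < x`, `x + r < 1` and `‖F z‖ ≤ M` on the sphere `|z − x| = r`:
`|σ^{(n)}(x)| ≤ n!·M/rⁿ`. [cite: KrantzParks2002, Prop. 2.2.10] -/
theorem abs_iteratedDeriv_smoothTransition_le_of_sphere {x r M : ℝ} (hr : 0 < r) (hrx : r < x) (hx1 : x + r < 1)
    (hM : ∀ z : ℂ, ‖z - x‖ = r → ‖stC z‖ ≤ M) (n : ℕ) :
    |iteratedDeriv n Real.smoothTransition x| ≤ n ! * M / r ^ n := by
  have hne : ∀ z : ℂ, ‖z - x‖ ≤ r → 1 + Complex.exp (z⁻¹ - (1 - z)⁻¹) ≠ 0 :=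
    fun z hz => stC_one_add_exp_ne_zero_of_mem_disc hr hrx hx1 hz
  refine (abs_iteratedDeriv_smoothTransition_le_norm_iteratedDeriv_stC hr hrx hx1 hne n).trans ?_
  have hdiff : DifferentiableOn ℂ stC (closedBall (x : ℂ) r) := fun z hz =>
    (differentiableAt_stC (stC_ne_zero_of_mem_disc hrx (mem_closedBall_iff_norm.1 hz))
      (stC_one_sub_ne_zero_of_mem_disc hx1 (mem_closedBall_iff_norm.1 hz)) (hne z (mem_closedBall_iff_norm.1 hz))).differentiableWithinAt
  have hdc : DiffContOnCl ℂ stC (ball (x : ℂ) r) := by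
    refine DifferentiableOn.diffContOnCl ?_
    rw [closure_ball _ hr.ne']
    exact hdiff
  exact Complex.norm_iteratedDeriv_le_of_forall_mem_sphere_norm_le n hr hdc (fun z hz => hM z (mem_sphere_iff_norm.1 hz))

/-! ## §2 Sphere geometry in the coordinate `u = Re z` -/

section sphere

variable {x r : ℝ} {z : ℂ}

/-- On the sphere: `|z|² = r² − x² + 2x·Re z`. -/
theorem stC_normSq_eq_of_sphere (hz : ‖z - x‖ = r) : Complex.normSq z = r ^ 2 - x ^ 2 + 2 * x * z.re := by
  have h : ‖z - (x : ℂ)‖ ^ 2 = (z.re - x) ^ 2 + z.im ^ 2 := by rw [Complex.sq_norm, Complex.normSq_apply]; simp; ring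
  rw [hz] at h
  rw [Complex.normSq_apply]; nlinarith [h]

/-- On the sphere: `|1 − z|² = 1 + r² − x² − 2(1−x)·Re z`. -/
theorem stC_normSq_one_sub_eq_of_sphere (hz : ‖z - x‖ = r) :
    Complex.normSq (1 - z) = 1 + r ^ 2 - x ^ 2 - 2 * (1 - x) * z.re := by
  have h : ‖z - (x : ℂ)‖ ^ 2 = (z.re - x) ^ 2 + z.im ^ 2 := by rw [Complex.sq_norm, Complex.normSq_apply]; simp; ring
  rw [hz] at h
  rw [Complex.normSq_apply]; simp; nlinarith [h]

/-- On the sphere: `(Im z)² = r² − (Re z − x)²`. -/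
theorem stC_im_sq_eq_of_sphere (hz : ‖z - x‖ = r) : z.im ^ 2 = r ^ 2 - (z.re - x) ^ 2 := by
  have h : ‖z - (x : ℂ)‖ ^ 2 = (z.re - x) ^ 2 + z.im ^ 2 := by rw [Complex.sq_norm, Complex.normSq_apply]; simp; ring
  rw [hz] at h; linarith

/-- **Arc 1 (real-part route)**: on the sphere with `Re z ≤ x + d` (`−r < d ≤ r`):
`Re(1/z − 1/(1−z)) ≥ (x+d)/(r²+x²+2xd) − (1−x−d)/((1−x)²+r²−2d(1−x))`. -/
theorem stC_re_exponent_ge_arc (hr : 0 < r) (hrx : r < x) (hx1 : x + r < 1) {d : ℝ} (hd1 : -r < d) (hd2 : d ≤ r)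
    (hz : ‖z - x‖ = r) (hu : z.re ≤ x + d) :
    (x + d) / (r ^ 2 + x ^ 2 + 2 * x * d) - (1 - x - d) / ((1 - x) ^ 2 + r ^ 2 - 2 * d * (1 - x)) ≤ (z⁻¹ - (1 - z)⁻¹).re := by
  have hz0 : z ≠ 0 := stC_ne_zero_of_mem_disc hrx hz.le
  have hz1 : (1 : ℂ) - z ≠ 0 := stC_one_sub_ne_zero_of_mem_disc hx1 hz.le
  have hN := stC_normSq_eq_of_sphere hz
  have hN1 := stC_normSq_one_sub_eq_of_sphere hz
  have hNpos : 0 < Complex.normSq z := Complex.normSq_pos.2 hz0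
  have hN1pos : 0 < Complex.normSq (1 - z) := Complex.normSq_pos.2 hz1
  have hulo : x - r ≤ z.re := by
    have := stC_im_sq_eq_of_sphere hz; nlinarith [sq_nonneg z.im]
  have hA0 : 0 < r ^ 2 + x ^ 2 + 2 * x * d := by nlinarith
  have hB0 : 0 < (1 - x) ^ 2 + r ^ 2 - 2 * d * (1 - x) := by nlinarith
  rw [Complex.sub_re, Complex.inv_re, Complex.inv_re]
  -- Re(1/z) = z.re / normSq z ≥ (x+d)/(r²+x²+2xd)
  have h1 : (x + d) / (r ^ 2 + x ^ 2 + 2 * x * d) ≤ z.re / Complex.normSq z := by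
    rw [div_le_div_iff₀ hA0 hNpos, hN]
    -- (x+d)(r² − x² + 2x u) ≤ u (r² + x² + 2xd)  ⟺ (x² − r²)(x + d − u) ≥ 0
    nlinarith [mul_nonneg (by nlinarith : (0:ℝ) ≤ x ^ 2 - r ^ 2) (by linarith : (0:ℝ) ≤ x + d - z.re)]
  -- Re(1/(1-z)) = (1-z).re / normSq (1-z) ≤ (1-x-d)/((1-x)²+r²-2d(1-x))
  have h2 : ((1 : ℂ) - z).re / Complex.normSq (1 - z) ≤ (1 - x - d) / ((1 - x) ^ 2 + r ^ 2 - 2 * d * (1 - x)) := by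
    rw [div_le_div_iff₀ hN1pos hB0, hN1]
    simp only [Complex.sub_re, Complex.one_re]
    -- (1-u)((1-x)²+r²-2d(1-x)) ≤ (1-x-d)(1+r²-x²-2(1-x)u) ⟺ ((1-x)² - r²)(x+d-u) ≥ 0
    nlinarith [mul_nonneg (by nlinarith : (0:ℝ) ≤ (1 - x) ^ 2 - r ^ 2) (by linarith : (0:ℝ) ≤ x + d - z.re)]
  linarith

/-- **Arc 3 (negative real-part route)**: on the sphere with `x + d ≤ Re z` (`−r < d ≤ r`):
`Re(1/z − 1/(1−z)) ≤ (x+d)/(r²+x²+2xd) − (1−x−d)/((1−x)²+r²−2d(1−x))`. -/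
theorem stC_re_exponent_le_arc (hr : 0 < r) (hrx : r < x) (hx1 : x + r < 1) {d : ℝ} (hd1 : -r < d) (hd2 : d ≤ r)
    (hz : ‖z - x‖ = r) (hu : x + d ≤ z.re) :
    (z⁻¹ - (1 - z)⁻¹).re ≤ (x + d) / (r ^ 2 + x ^ 2 + 2 * x * d) - (1 - x - d) / ((1 - x) ^ 2 + r ^ 2 - 2 * d * (1 - x)) := by
  have hz0 : z ≠ 0 := stC_ne_zero_of_mem_disc hrx hz.le
  have hz1 : (1 : ℂ) - z ≠ 0 := stC_one_sub_ne_zero_of_mem_disc hx1 hz.le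
  have hN := stC_normSq_eq_of_sphere hz
  have hN1 := stC_normSq_one_sub_eq_of_sphere hz
  have hNpos : 0 < Complex.normSq z := Complex.normSq_pos.2 hz0
  have hN1pos : 0 < Complex.normSq (1 - z) := Complex.normSq_pos.2 hz1
  have huhi : z.re ≤ x + r := by
    have := stC_im_sq_eq_of_sphere hz; nlinarith [sq_nonneg z.im]
  have hA0 : 0 < r ^ 2 + x ^ 2 + 2 * x * d := by nlinarith
  have hB0 : 0 < (1 - x) ^ 2 + r ^ 2 - 2 * d * (1 - x) := by nlinarith
  rw [Complex.sub_re, Complex.inv_re, Complex.inv_re]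
  have h1 : z.re / Complex.normSq z ≤ (x + d) / (r ^ 2 + x ^ 2 + 2 * x * d) := by
    rw [div_le_div_iff₀ hNpos hA0, hN]
    nlinarith [mul_nonneg (by nlinarith : (0:ℝ) ≤ x ^ 2 - r ^ 2) (by linarith : (0:ℝ) ≤ z.re - (x + d))]
  have h2 : (1 - x - d) / ((1 - x) ^ 2 + r ^ 2 - 2 * d * (1 - x)) ≤ ((1 : ℂ) - z).re / Complex.normSq (1 - z) := by
    rw [div_le_div_iff₀ hB0 hN1pos, hN1]
    simp only [Complex.sub_re, Complex.one_re]
    nlinarith [mul_nonneg (by nlinarith : (0:ℝ) ≤ (1 - x) ^ 2 - r ^ 2) (by linarith : (0:ℝ) ≤ z.re - (x + d))]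
  linarith

/-- **Arc 2, first term**: on the sphere with `x + d ≤ Re z` (`−r < d`) and `|Im z| ≤ s` (`0 ≤ s`):
`|Im(1/z)| ≤ s/(r²+x²+2xd)`. -/
theorem stC_abs_im_inv_le_arc (hr : 0 < r) (hrx : r < x) {d s : ℝ} (hd1 : -r < d) (hs : 0 ≤ s)
    (hz : ‖z - x‖ = r) (hu : x + d ≤ z.re) (him : |z.im| ≤ s) :
    |(z⁻¹).im| ≤ s / (r ^ 2 + x ^ 2 + 2 * x * d) := by
  have hz0 : z ≠ 0 := stC_ne_zero_of_mem_disc hrx hz.le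
  have hN := stC_normSq_eq_of_sphere hz
  have hNpos : 0 < Complex.normSq z := Complex.normSq_pos.2 hz0
  have hA0 : 0 < r ^ 2 + x ^ 2 + 2 * x * d := by nlinarith
  have hNge : r ^ 2 + x ^ 2 + 2 * x * d ≤ Complex.normSq z := by rw [hN]; nlinarith
  rw [Complex.inv_im, abs_div, abs_neg, abs_of_pos hNpos]
  calc |z.im| / Complex.normSq z ≤ s / Complex.normSq z := by gcongr
    _ ≤ s / (r ^ 2 + x ^ 2 + 2 * x * d) := div_le_div_of_nonneg_left hs hA0 hNge

/-- **Arc 2, second term**: on the sphere with `Re z ≤ x + d` (`d ≤ r`, `x + r < 1`) and `|Im z| ≤ s`: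
`|Im(1/(1−z))| ≤ s/((1−x)²+r²−2d(1−x))`. -/
theorem stC_abs_im_inv_one_sub_le_arc (hr : 0 < r) (hx1 : x + r < 1) {d s : ℝ} (hd2 : d ≤ r) (hs : 0 ≤ s)
    (hz : ‖z - x‖ = r) (hu : z.re ≤ x + d) (him : |z.im| ≤ s) :
    |((1 - z)⁻¹).im| ≤ s / ((1 - x) ^ 2 + r ^ 2 - 2 * d * (1 - x)) := by
  have hz1 : (1 : ℂ) - z ≠ 0 := stC_one_sub_ne_zero_of_mem_disc hx1 hz.le
  have hN1 := stC_normSq_one_sub_eq_of_sphere hz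
  have hN1pos : 0 < Complex.normSq (1 - z) := Complex.normSq_pos.2 hz1
  have hB0 : 0 < (1 - x) ^ 2 + r ^ 2 - 2 * d * (1 - x) := by nlinarith
  have hNge : (1 - x) ^ 2 + r ^ 2 - 2 * d * (1 - x) ≤ Complex.normSq (1 - z) := by rw [hN1]; nlinarith
  have him' : |((1 : ℂ) - z).im| = |z.im| := by simp
  rw [Complex.inv_im, abs_div, abs_neg, abs_of_pos hN1pos, him']
  calc |z.im| / Complex.normSq (1 - z) ≤ s / Complex.normSq (1 - z) := by gcongr
    _ ≤ s / ((1 - x) ^ 2 + r ^ 2 - 2 * d * (1 - x)) := div_le_div_of_nonneg_left hs hB0 hNge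

/-- On the sphere with `x + d ≤ Re z`, `0 ≤ d`: `|Im z|² ≤ r² − d²`, so `|Im z| ≤ s` whenever `r² − d² ≤ s²`, `0 ≤ s`. -/
theorem stC_abs_im_le_of_arc (hz : ‖z - x‖ = r) {d s : ℝ} (hd : 0 ≤ d) (hu : x + d ≤ z.re) (hs : 0 ≤ s) (hs2 : r ^ 2 - d ^ 2 ≤ s ^ 2) :
    |z.im| ≤ s := by
  have h := stC_im_sq_eq_of_sphere hz
  have h2 : z.im ^ 2 ≤ s ^ 2 := by nlinarith
  exact abs_le_of_sq_le_sq' h2 hs |> fun h => abs_le.2 ⟨by linarith [h.1], h.2⟩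

/-- On the sphere: `|Im z| ≤ r`. -/
theorem stC_abs_im_le_radius (hz : ‖z - x‖ = r) : |z.im| ≤ r := by
  have h1 : |(z - x).im| ≤ ‖z - (x : ℂ)‖ := Complex.abs_im_le_norm _
  have h2 : (z - (x : ℂ)).im = z.im := by simp
  rw [h2, hz] at h1; exact h1

end sphere

/-! ## §3 From the exponent bounds to majorants of `F` -/

/-- Real-part route: `Re w ≥ τ > 0` gives `‖(1 + eʷ)⁻¹‖ ≤ (e^τ − 1)⁻¹`. -/
theorem stC_norm_le_of_re_ge {z : ℂ} {τ : ℝ} (hτ : 0 < τ) (h : τ ≤ (z⁻¹ - (1 - z)⁻¹).re) : ‖stC z‖ ≤ (Real.exp τ - 1)⁻¹ := by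
  have hlow : Real.exp τ - 1 ≤ ‖1 + Complex.exp (z⁻¹ - (1 - z)⁻¹)‖ := by
    have h1 := stC_norm_one_add_exp_ge_exp_re_sub_one (z⁻¹ - (1 - z)⁻¹)
    have h2 : Real.exp τ ≤ Real.exp (z⁻¹ - (1 - z)⁻¹).re := Real.exp_le_exp.2 h
    linarith
  have hpos : 0 < Real.exp τ - 1 := by linarith [Real.add_one_lt_exp hτ.ne']
  rw [stC, norm_inv]; exact inv_anti₀ hpos hlow

/-- Negative real-part route: `Re w ≤ −τ < 0` gives `‖(1 + eʷ)⁻¹‖ ≤ (1 − e^{−τ})⁻¹`. -/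
theorem stC_norm_le_of_re_le {z : ℂ} {τ : ℝ} (hτ : 0 < τ) (h : (z⁻¹ - (1 - z)⁻¹).re ≤ -τ) : ‖stC z‖ ≤ (1 - Real.exp (-τ))⁻¹ := by
  have hlow : 1 - Real.exp (-τ) ≤ ‖1 + Complex.exp (z⁻¹ - (1 - z)⁻¹)‖ := by
    have h1 := stC_norm_one_add_exp_ge_one_sub_exp_re (z⁻¹ - (1 - z)⁻¹)
    have h2 : Real.exp (z⁻¹ - (1 - z)⁻¹).re ≤ Real.exp (-τ) := Real.exp_le_exp.2 h
    linarith
  have hpos : 0 < 1 - Real.exp (-τ) := by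
    have : Real.exp (-τ) < 1 := Real.exp_lt_one_iff.2 (by linarith)
    linarith
  rw [stC, norm_inv]; exact inv_anti₀ hpos hlow

/-- Imaginary-part route, `M = 1`: `|Im w| ≤ 3/2` gives `‖(1 + eʷ)⁻¹‖ ≤ 1`. -/
theorem stC_norm_le_one_of_abs_im_le {z : ℂ} (h : |(z⁻¹ - (1 - z)⁻¹).im| ≤ 3 / 2) : ‖stC z‖ ≤ 1 := by
  have hlow := stC_norm_one_add_exp_ge_one_of_abs_im_le h
  rw [stC, norm_inv]; exact inv_le_one_of_one_le₀ hlow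

/-- Imaginary-part route, `M = 2`: `|Im w| ≤ 5/2` gives `‖(1 + eʷ)⁻¹‖ ≤ 2`. -/
theorem stC_norm_le_two_of_abs_im_le {z : ℂ} (h : |(z⁻¹ - (1 - z)⁻¹).im| ≤ 5 / 2) : ‖stC z‖ ≤ 2 := by
  have hlow := stC_norm_one_add_exp_ge_half_of_abs_im_le h
  rw [stC, norm_inv]
  calc ‖1 + Complex.exp (z⁻¹ - (1 - z)⁻¹)‖⁻¹ ≤ (1 / 2)⁻¹ := inv_anti₀ (by norm_num) hlow
    _ = 2 := by norm_num

/-- `Im(1/z − 1/(1−z))` splits: `|Im w| ≤ |Im(1/z)| + |Im(1/(1−z))|`. -/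
theorem stC_abs_im_exponent_le_add (z : ℂ) : |(z⁻¹ - (1 - z)⁻¹).im| ≤ |(z⁻¹).im| + |((1 - z)⁻¹).im| := by
  rw [Complex.sub_im]; exact abs_sub _ _

/-- A rational lower bound for `e^τ`: `2.7182818283ᵏ·(1 + (τ − k)) ≤ e^τ` for `k ≤ τ`. -/
theorem stC_exp_ge_rat {τ : ℝ} (k : ℕ) (hk : (k : ℝ) ≤ τ) : (2.7182818283 : ℝ) ^ k * (1 + (τ - k)) ≤ Real.exp τ := by
  have h1 : (2.7182818283 : ℝ) ^ k ≤ Real.exp k := by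
    rw [show (k : ℝ) = k * 1 by ring, Real.exp_nat_mul]
    exact pow_le_pow_left₀ (by norm_num) Real.exp_one_gt_d9.le k
  have h2 : 1 + (τ - k) ≤ Real.exp (τ - k) := by linarith [Real.add_one_le_exp (τ - k)]
  calc (2.7182818283 : ℝ) ^ k * (1 + (τ - k)) ≤ Real.exp k * Real.exp (τ - k) := mul_le_mul h1 h2 (by linarith) (Real.exp_pos _).le
    _ = Real.exp τ := by rw [← Real.exp_add]; ring_nf

end Summit.HubbardSuperconductivity.HubbardSuperconductivity.Theorems.KLRegimeSplit

end
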